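import Literature.NumberTheory.Automorphic.ArchTorusNormalisedFamily       -- ★ (V2) global: `exists_isQuotientOf_archDiagTorus`; ★ D1′b₃ `centralizer_archDiagTorus_eq_range`, `isCompact_range_archDiagTorus`
import Literature.NumberTheory.Automorphic.CompactGroupOrbitalIntegral    -- ★ D1′c∕B2 (p08): `compactSpace_arch_cm`, `exists_bound_archWeylDiscr_rpow_smul_integral_conj_arch`, `orbitalIntegral_quotientMeasure_eq_inv_smul`
import HarnessLib

/-!
# Harish-Chandra's bound `|D(γ)|^{1∕2} Φ_γ(f) = O(1)` on the regular diagonal torus of a TOTALLY DEFINITE `U(diag α)(L⁺ ⊗ ℝ)`, torus-normalised (road D1′ ∕ «D2′», (L-cpt))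
# (Rogawski 1990 §14.5 p. 238; Varadarajan 1989 §2.4)

Topic `NumberTheory/Automorphic`; namespace `Literature.NumberTheory.Automorphic.UnitaryGroup`.  THEOREMS ONLY (no definition, no named fact, no instance, no
notation, no `sorry`).  Cell `hodgecm-mathlib`, floor-1 prep under #88 (ST-∞) ∕ #111 (S-d): the COMPACT-PLACE letter (L-cpt) of CENSUS-D2prime-HClimit §2, in the
honest torus normalisation — the junction of ★ «D2′a» (V2) `exists_isQuotientOf_archDiagTorus` (F0P3a-p02: ONE Haar measure `t_T` on the diagonal circle torus
normalises every regular torus class) with ★ D1′c∕B2 (F0P3a-p08: `|D|^{1∕2} · ∫ f(gγg^{-1}) dν` bounded on the compact group and the Weil-form dress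
`O_γ(f) = t_γ(G_γ)^{-1} · ∫ f(gγg^{-1}) dν`): **for a totally definite diagonal hermitian `α`, every Haar `ν` and every Haar `t_T` there is `C` with
`‖ |D(t(z))|^{1∕2} · O_{t(z)}(f) ‖ ≤ C` for ALL regular torus points `t(z)`**, the orbit measures being `dν ∕ dt_T` — [Rogawski1990] §14.5 p. 238 «since `G′_v` is
compact», [Varadarajan1989] §2.4 (compact `U(n)`: `F_f` continuous on the whole torus).

* **`UnitaryGroup.exists_bound_archWeylDiscr_rpow_smul_orbitalIntegral_archDiagTorus`**.

JUNK AUDIT: `hdef` (total definiteness of `diag α` at every complex place) is what makes `G′_∞` compact — at an indefinite place the statement is Harish-Chandra's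
genuine theorem (letter (L-H), untouched); `hα : α_i ≠ 0` is implied by `hdef` morally but kept as the hypothesis ★ `centralizer_archDiagTorus_eq_range` asks; the
mass `t_T(T)` is positive and finite (Haar on the compact torus) and VISIBLE in the proof (`C = t_T(T)^{-1} · C₀`); nothing relates `t_T` to `ν`.
HONEST LABEL: HC_CM is proved only modulo the printed citations until rung 0 closes; count-neutral floor-1 preparation (the compact half of D1′∕D2′).

## References
* J. D. Rogawski, *Automorphic Representations of Unitary Groups in Three Variables*, Ann. of Math. Stud. 123 (1990), §14.5 p. 238 (proof of L. 14.5.2: «`lim D_G(γ′)Φ(γ′,f′_v)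
  = 0` since `G′_v` is compact»), §8.2 pp. 122–124 [Rogawski1990].
* V. S. Varadarajan, *An Introduction to Harmonic Analysis on Semisimple Lie Groups* (1989), §2.4 Thm. 8 (orbital integrals on compact `U(n)`) [Varadarajan1989].
-/

set_option autoImplicit false

noncomputable section

open MeasureTheory Measure NumberField NumberField.InfinitePlace Literature.MeasureTheory.Group
open scoped MatrixGroups ComplexOrder

namespace Literature.NumberTheory.Automorphic

namespace UnitaryGroup

variable (L : Type) [Field L] [NumberField L] [IsCMField L] (N : ℕ) (α : Fin N → L)

/-- **HARISH-CHANDRA'S BOUND AT THE DEFINITE PLACES, TORUS-NORMALISED**: `diag α` totally definite, `ν` a Haar measure on `G′_∞ = U(diag α)(L⁺ ⊗ ℝ)`, `t_T` a Haar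
measure on the diagonal circle torus `T`, `f` continuous.  Then for the torus-normalised centraliser measures `t` of ★ `exists_isQuotientOf_archDiagTorus`
(`t (t(z)) = t_T` transported, `z` regular) — which come with a Weil-form orbital-measure family `m`, `IsQuotientOf` — there is ONE constant `C` with
`‖ |D(t(z))|_∞^{1∕2} · O_{t(z)}(f) ‖ ≤ C` for EVERY regular torus point (`O_γ(f)` = ★ `orbitalIntegral` against ★ `quotientMeasure Z(γ) (t γ) ν = dν∕dt_T`; the Haar ∕
inversion-invariance of `t (t(z))` are exported as the anonymous witnesses that make `quotientMeasure` well-typed, as in ★ `IsQuotientOf`).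
[cite: Rogawski1990, §14.5 p. 238] [cite: Varadarajan1989, §2.4 Thm. 8] -/
theorem exists_bound_archWeylDiscr_rpow_smul_orbitalIntegral_archDiagTorus
    (hdef : ∀ w : {w : InfinitePlace L // InfinitePlace.IsComplex w},
      ((Matrix.diagonal α).map w.1.embedding).PosDef ∨ (-(Matrix.diagonal α).map w.1.embedding).PosDef)
    (hα : ∀ i, α i ≠ 0)
    [MeasurableSpace (arch (↥(maximalRealSubfield L)) L (IsCMField.complexConj L) N (Matrix.diagonal α))]
    [BorelSpace (arch (↥(maximalRealSubfield L)) L (IsCMField.complexConj L) N (Matrix.diagonal α))]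
    [∀ γ : arch (↥(maximalRealSubfield L)) L (IsCMField.complexConj L) N (Matrix.diagonal α),
      MeasurableSpace (arch (↥(maximalRealSubfield L)) L (IsCMField.complexConj L) N (Matrix.diagonal α) ⧸
        Subgroup.centralizer ({γ} : Set (arch (↥(maximalRealSubfield L)) L (IsCMField.complexConj L) N (Matrix.diagonal α))))]
    [∀ γ : arch (↥(maximalRealSubfield L)) L (IsCMField.complexConj L) N (Matrix.diagonal α),
      BorelSpace (arch (↥(maximalRealSubfield L)) L (IsCMField.complexConj L) N (Matrix.diagonal α) ⧸
        Subgroup.centralizer ({γ} : Set (arch (↥(maximalRealSubfield L)) L (IsCMField.complexConj L) N (Matrix.diagonal α))))]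
    (ν : Measure (arch (↥(maximalRealSubfield L)) L (IsCMField.complexConj L) N (Matrix.diagonal α))) [ν.IsHaarMeasure] [ν.IsMulRightInvariant]
    (tT : Measure ↥((archDiagTorus L N α).range)) [tT.IsHaarMeasure]
    {E : Type*} [NormedAddCommGroup E] [NormedSpace ℝ E]
    (f : arch (↥(maximalRealSubfield L)) L (IsCMField.complexConj L) N (Matrix.diagonal α) → E) (hf : Continuous f) :
    ∃ (t : ∀ γ : arch (↥(maximalRealSubfield L)) L (IsCMField.complexConj L) N (Matrix.diagonal α),
          Measure (Subgroup.centralizer ({γ} : Set (arch (↥(maximalRealSubfield L)) L (IsCMField.complexConj L) N (Matrix.diagonal α)))))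
      (m : OrbitalMeasureFamily (arch (↥(maximalRealSubfield L)) L (IsCMField.complexConj L) N (Matrix.diagonal α))) (C : ℝ),
      m.IsQuotientOf
        (fun γ => ∃ z : {w : InfinitePlace L // IsComplex w} → Fin N → Circle, (∀ w, Function.Injective (z w)) ∧ γ = archDiagTorus L N α z)
        ν t ∧
      ∀ (z : {w : InfinitePlace L // IsComplex w} → Fin N → Circle), (∀ w, Function.Injective (z w)) →
        ∃ (_ : (t (archDiagTorus L N α z)).IsHaarMeasure) (_ : (t (archDiagTorus L N α z)).IsInvInvariant),
        ‖(archWeylDiscr ((archDiagTorus L N α z : GL (Fin N) (mixedEmbedding.mixedSpace L)) :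
              Matrix (Fin N) (Fin N) (mixedEmbedding.mixedSpace L))) ^ (1 / 2 : ℝ) •
          orbitalIntegral (archDiagTorus L N α z) f
            (quotientMeasure (Subgroup.centralizer {archDiagTorus L N α z}) (t (archDiagTorus L N α z))
              (isClosed_coe_centralizer_singleton (archDiagTorus L N α z)) ν)‖ ≤ C := by
  haveI : CompactSpace (arch (↥(maximalRealSubfield L)) L (IsCMField.complexConj L) N (Matrix.diagonal α)) :=
    compactSpace_arch_cm L (Matrix.diagonal α) hdef
  -- the torus-normalised family (★ (V2) global)
  obtain ⟨t, m, ht, hm⟩ := exists_isQuotientOf_archDiagTorus L N α hα ν tT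
  -- the un-normalised bound on the compact group (★ D1′c∕B2)
  obtain ⟨C₀, hC₀⟩ := exists_bound_archWeylDiscr_rpow_smul_integral_conj_arch L (Matrix.diagonal α) hdef ν f hf
  -- the torus mass: positive and finite
  haveI : CompactSpace ↥((archDiagTorus L N α).range) :=
    isCompact_iff_compactSpace.mp (isCompact_range_archDiagTorus L N α)
  have hmass_top : tT Set.univ < ⊤ := IsCompact.measure_lt_top isCompact_univ
  have hmass_pos : 0 < tT Set.univ := IsOpen.measure_pos tT isOpen_univ Set.univ_nonempty
  have hreal : 0 < tT.real Set.univ := by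
    rw [measureReal_def]
    exact ENNReal.toReal_pos hmass_pos.ne' hmass_top.ne
  refine ⟨t, m, (tT.real Set.univ)⁻¹ * C₀, hm, fun z hz => ?_⟩
  -- at a regular torus point `t γ` is `t_T` transported: Haar, inversion invariant, of mass `t_T(T)`
  have hmeas : Measurable (MulEquiv.subgroupCongr (centralizer_archDiagTorus_eq_range L N α hα hz).symm) :=
    (continuous_subgroupCongr (centralizer_archDiagTorus_eq_range L N α hα hz).symm).1.measurable
  haveI hH : (t (archDiagTorus L N α z)).IsHaarMeasure := by
    rw [ht z hz]
    exact isHaarMeasure_map_subgroupCongr _ tT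
  haveI : (t (archDiagTorus L N α z)).IsMulRightInvariant :=
    isMulRightInvariant_of_forall_comm (Subgroup.centralizer {archDiagTorus L N α z}) (isClosed_coe_centralizer_singleton _)
      (fun a ha b hb => by
        rw [centralizer_archDiagTorus_eq_range L N α hα hz] at ha hb
        obtain ⟨za, rfl⟩ := ha
        obtain ⟨zb, rfl⟩ := hb
        exact archDiagTorus_mul_comm L N α za zb) _
  haveI hI : (t (archDiagTorus L N α z)).IsInvInvariant :=
    Literature.MeasureTheory.Group.isInvInvariant_of_isMulRightInvariant_of_isClosed (Subgroup.centralizer {archDiagTorus L N α z})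
      (isClosed_coe_centralizer_singleton _) _
  refine ⟨hH, hI, ?_⟩
  have hmass : (t (archDiagTorus L N α z)).real Set.univ = tT.real Set.univ := by
    rw [measureReal_def, measureReal_def, ht z hz, Measure.map_apply hmeas MeasurableSet.univ, Set.preimage_univ]
  rw [orbitalIntegral_quotientMeasure_eq_inv_smul ν (archDiagTorus L N α z) (t (archDiagTorus L N α z)) f hf, smul_comm, norm_smul, norm_inv,
    hmass, Real.norm_of_nonneg hreal.le]
  exact mul_le_mul_of_nonneg_left (hC₀ _) (inv_nonneg.2 hreal.le)

end UnitaryGroup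

end Literature.NumberTheory.Automorphic

end
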